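import Summits.ValiantsHypothesis.ValiantsHypothesis.Theorems.LacunarySymmetroidMatrixDescartesCensusDoorA34CommonEigenvector

/-!
# `MatrixDescartes` census — DOOR A at `(3,4)`: the COMMON-EIGENVECTOR law, MIXED case — three letters with a common eigenvector, two DEFINITE
# blocks and ONE INDEFINITE block: `Z₊ ≤ 18` whenever an edge through the indefinite block does not alternate exactly once or twice

HONEST FRAMING.  Object-search cell `pub-symmetroid`, door-A seat `val-sym-door-p3` (g14); helper file beside the OPEN typed statement
`DoorA34 = PosRootLawAt 3 4 18` (route item `Theses.LacunarySymmetroid.DoorA34`, stmt-ValiantsHypothesis-19980), asserted nowhere.  Fourth instance of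
the EDGE-EXACTNESS mechanism (`…IsotropicTangent`, `…DiagonalTriple`, `…CommonEigenvector`); it completes the «common eigenvector» family of
`…CommonEigenvector` to AT MOST ONE indefinite complementary block (two indefinite blocks make the edge between them possibly non-hyperbolic, where
Descartes need not be exact).

THE FAMILY.  Letters `S_i, S_j, S_k` (indices `≠ m`) symmetric of block form `[[p,q,0],[q,r,0],[0,0,λ]]` (common eigenvector `e₂`), with
`det B_i, det B_j > 0` (DEFINITE blocks) and `det B_k < 0` (INDEFINITE block); `S_m` arbitrary.  On an edge `{a,k}` (`a ∈ {i,j}`) the edge cubic is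
`(λ_a + λ_k s)(D_a + M s + D_k s²)` with `D_a D_k < 0`: the quadratic factor has two real roots OF OPPOSITE SIGNS, so the cubic is real-rooted and

* `mixedLin_sign_of_parities` — DESCARTES IS EXACT with count `[λ_aλ_k < 0] + 1 ∈ {1, 2}`: the edge alternates EXACTLY ONCE OR TWICE (no magnitude
  hypothesis at all — the two impossible patterns `0` and `3` would force `M > 0` and `M < 0` simultaneously);
* `mixed_edge_count` — for a NINETEEN the alternation count of the edge is a function of `d` (ranks in the triple-sum table, `…FullAlternation`);
* **`card_posRoots_commonEigMixed_le_18`** — hence if `d` makes one of the two edges `{i,k}`, `{j,k}` alternate `0` or `3` times, no such pencil has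
  `19` roots: **`Z₊ ≤ 18`**; congruence form `card_posRoots_commonEigMixed_congr_le_18`; instance `…_on_0_1_7_11` (`m = 0`, indefinite block at `X^1`:
  the edge `{X^1, X^7}` alternates `3` times).

SCOPE (located bookkeeping): an edge count `V_ab ∈ {0,3}` occurs on at least one of the two edges through `k` for most `(d, m, k)`; e.g. on
`(0,1,7,11)`, `m = 0`, for EVERY choice of the indefinite block `k ∈ {1,2,3}` (`V₁₂ = 3`, `V₁₃ = 2`, `V₂₃ = 3`), so together with `…CommonEigenvector`
(all blocks definite) the row `Z₊ ≤ 18` holds there for every common-eigenvector triple with at most one indefinite block.  Nothing here bounds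
`ζ_sym(3,4)` (`∈ {18,19}` unchanged) or `DoorA34`; nothing bears on `MatrixDescartes` (stmt-ValiantsHypothesis-18050) or on `VP ≠ VNP` — VP≠VNP not moved.

[folklore] Descartes' rule of signs is exact for real-rooted polynomials; elementary.
-/

-- `Summit.ValiantsHypothesis.ValiantsHypothesis.…` repeats a component by the D-0017 layout
-- (single-conjunct summit), which the `dupNamespace` linter flags; the name is mandated.
set_option linter.dupNamespace false

namespace Summit.ValiantsHypothesis.ValiantsHypothesis.Theorems.LacunarySymmetroidMatrixDescartes.Census

open Polynomial Finset
open scoped BigOperators Polynomial Matrix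
open Summit.ValiantsHypothesis.ValiantsHypothesis.Theorems.LacunarySymmetroidMatrixDescartes.Census.SignSplit (pencil posRootCount)

/-! ## 1. Descartes is exact for `(λ_a + λ_k s)(D_a + M s + D_k s²)` with `D_a D_k < 0` -/

/-- **Sign law for the mixed edge cubic (parity form).**  With `c₀ = λ_a D_a, c₁ = λ_k D_a + λ_a M, c₂ = λ_k M + λ_a D_k, c₃ = λ_k D_k`, `D_a > 0 > D_k`,
`λ_aλ_k ≠ 0`, and adjacent products of signs `(−1)^{sₙ}`: the number of odd `sₙ` is `1` if `λ_aλ_k > 0` and `2` if `λ_aλ_k < 0`. [folklore] -/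
theorem mixedLin_sign_of_parities {la lk Da Dk M c₀ c₁ c₂ c₃ : ℝ} {s₁ s₂ s₃ : ℕ}
    (hDa : 0 < Da) (hDk : Dk < 0) (hla : la ≠ 0) (hlk : lk ≠ 0)
    (hc₀ : c₀ = la * Da) (hc₁ : c₁ = lk * Da + la * M) (hc₂ : c₂ = lk * M + la * Dk) (hc₃ : c₃ = lk * Dk)
    (h₁ : 0 < (-1 : ℝ) ^ s₁ * (c₀ * c₁)) (h₂ : 0 < (-1 : ℝ) ^ s₂ * (c₁ * c₂)) (h₃ : 0 < (-1 : ℝ) ^ s₃ * (c₂ * c₃)) :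
    s₁ % 2 + s₂ % 2 + s₃ % 2 = (if la * lk < 0 then 1 else 0) + 1 := by
  subst hc₀ hc₁ hc₂ hc₃
  have odd_of_neg : ∀ {s : ℕ} {x : ℝ}, 0 < (-1 : ℝ) ^ s * x → x < 0 → s % 2 = 1 := fun {s x} hx hneg => by
    rcases Nat.mod_two_eq_zero_or_one s with h | h
    · rw [(Nat.even_iff.mpr h).neg_one_pow] at hx; linarith
    · exact h
  have even_of_pos : ∀ {s : ℕ} {x : ℝ}, 0 < (-1 : ℝ) ^ s * x → 0 < x → s % 2 = 0 := fun {s x} hx hpos => by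
    rcases Nat.mod_two_eq_zero_or_one s with h | h
    · exact h
    · rw [(Nat.odd_iff.mpr h).neg_one_pow] at hx; linarith
  have neg_of_odd : ∀ {s : ℕ} {x : ℝ}, 0 < (-1 : ℝ) ^ s * x → s % 2 = 1 → x < 0 := fun {s x} hx hs => by
    rw [(Nat.odd_iff.mpr hs).neg_one_pow] at hx; linarith
  have pos_of_even : ∀ {s : ℕ} {x : ℝ}, 0 < (-1 : ℝ) ^ s * x → s % 2 = 0 → 0 < x := fun {s x} hx hs => by
    rw [(Nat.even_iff.mpr hs).neg_one_pow] at hx; linarith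
  have hla2 : 0 < la ^ 2 := by positivity
  have hlk2 : 0 < lk ^ 2 := by positivity
  -- total parity: sign of c₀c₃ = λaλk·DaDk = −sign(λaλk)
  have htot : 0 < (-1 : ℝ) ^ (s₁ + s₂ + s₃) * ((la * lk) * (Da * Dk)) := by
    have hp := mul_pos (mul_pos h₁ h₂) h₃
    have e : (-1 : ℝ) ^ s₁ * (la * Da * (lk * Da + la * M)) * ((-1) ^ s₂ * ((lk * Da + la * M) * (lk * M + la * Dk)))
        * ((-1) ^ s₃ * ((lk * M + la * Dk) * (lk * Dk)))
        = ((-1 : ℝ) ^ (s₁ + s₂ + s₃) * ((la * lk) * (Da * Dk))) * ((lk * Da + la * M) ^ 2 * (lk * M + la * Dk) ^ 2) := by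
      rw [pow_add, pow_add]; ring
    rw [e] at hp
    have hc1 : lk * Da + la * M ≠ 0 := by rintro h; rw [h] at h₁; simp at h₁
    have hc2 : lk * M + la * Dk ≠ 0 := by rintro h; rw [h] at h₃; simp at h₃
    exact (pos_iff_pos_of_mul_pos hp).mpr (by positivity)
  obtain ⟨m1, m2, m3⟩ := And.intro (Nat.mod_two_eq_zero_or_one s₁) (And.intro (Nat.mod_two_eq_zero_or_one s₂) (Nat.mod_two_eq_zero_or_one s₃))
  rcases lt_or_gt_of_ne (mul_ne_zero hla hlk) with hl | hl
  · -- λλ < 0 : c₀c₃ > 0, total parity even, and «all permanences» is impossible ⇒ exactly two alternations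
    rw [if_pos hl]
    have hpar : (s₁ + s₂ + s₃) % 2 = 0 := even_of_pos htot (by nlinarith [mul_neg_of_pos_of_neg hDa hDk])
    have hnot : ¬ (0 < la * Da * (lk * Da + la * M) ∧ 0 < (lk * M + la * Dk) * (lk * Dk)) := by
      rintro ⟨k1, k2⟩
      -- k1 ⇒ λa²·Da·M > −λλ·Da² > 0 ⇒ M > 0 ;  k2 ⇒ λk²·M·Dk > −λλ·Dk² > 0 ⇒ M < 0
      have hM1 : 0 < M := by
        by_contra hc; push Not at hc
        nlinarith [mul_pos hDa hDa, mul_nonpos_of_nonneg_of_nonpos (mul_pos hla2 hDa).le hc]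
      have hM2 : M < 0 := by
        by_contra hc; push Not at hc
        nlinarith [mul_pos_of_neg_of_neg hDk hDk, mul_nonpos_of_nonneg_of_nonpos (mul_nonneg hlk2.le hc) hDk.le]
      linarith
    rcases m1 with a | a <;> rcases m2 with b | b <;> rcases m3 with c | c <;> simp only [a, b, c] at hpar ⊢ <;> try omega
    all_goals exact absurd (And.intro (pos_of_even h₁ a) (pos_of_even h₃ c)) hnot
  · -- λλ > 0 : c₀c₃ < 0, total parity odd, and «all alternations» is impossible ⇒ exactly one alternation
    rw [if_neg (not_lt.mpr hl.le)]
    have hpar : (s₁ + s₂ + s₃) % 2 = 1 := odd_of_neg htot (by nlinarith [mul_neg_of_pos_of_neg hDa hDk])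
    have hnot : ¬ (la * Da * (lk * Da + la * M) < 0 ∧ (lk * M + la * Dk) * (lk * Dk) < 0) := by
      rintro ⟨k1, k2⟩
      have hM1 : M < 0 := by
        by_contra hc; push Not at hc
        nlinarith [mul_pos hDa hDa, mul_nonneg (mul_pos hla2 hDa).le hc]
      have hM2 : 0 < M := by
        by_contra hc; push Not at hc
        nlinarith [mul_pos_of_neg_of_neg hDk hDk, mul_nonneg_of_nonpos_of_nonpos (mul_nonpos_of_nonneg_of_nonpos hlk2.le hc) hDk.le]
      linarith
    rcases m1 with a | a <;> rcases m2 with b | b <;> rcases m3 with c | c <;> simp only [a, b, c] at hpar ⊢ <;> try omega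
    all_goals exact absurd (And.intro (neg_of_odd h₁ a) (neg_of_odd h₃ c)) hnot

/-! ## 2. A nineteen with a definite block letter and an indefinite block letter: the edge alternates once or twice -/

/-- **Mixed edge count for a nineteen.**  `S_a` a symmetric block letter with definite block, `S_k` one with indefinite block (`det B_k < 0`),
`19` positive det-roots, `ρ` the rank function of the triple-sum table: the number of odd adjacent rank-sums on the edge `{a,k}` is
`[λ_aλ_k < 0] + 1`, in particular it is `1` or `2`. [folklore] -/
theorem mixed_edge_count (d : Fin 4 → ℕ) (S : Fin 4 → Matrix (Fin 3) (Fin 3) ℝ) {a k : Fin 4} (hak : a ≠ k)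
    (ha : S a 0 2 = 0 ∧ S a 1 2 = 0 ∧ S a 2 0 = 0 ∧ S a 2 1 = 0 ∧ S a 1 0 = S a 0 1)
    (hk : S k 0 2 = 0 ∧ S k 1 2 = 0 ∧ S k 2 0 = 0 ∧ S k 2 1 = 0 ∧ S k 1 0 = S k 0 1)
    (hda : 0 < S a 0 0 * S a 1 1 - S a 0 1 ^ 2) (hdk : S k 0 0 * S k 1 1 - S k 0 1 ^ 2 < 0)
    (h19 : 19 ≤ ((Matrix.det (∑ l, ((X : ℝ[X]) ^ d l) • (S l).map C)).roots.toFinset.filter (fun t => 0 < t)).card)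
    (ρ : ℕ → ℕ) (hρ : ∀ e, ρ e = (((Finset.univ : Finset (Fin 4 × Fin 4 × Fin 4)).image
      (fun p => d p.1 + d p.2.1 + d p.2.2)).filter (· < e)).card) :
    (ρ (3 * d a) + ρ (2 * d a + d k)) % 2 + (ρ (2 * d a + d k) + ρ (2 * d k + d a)) % 2 + (ρ (2 * d k + d a) + ρ (3 * d k)) % 2
      = (if S a 2 2 * S k 2 2 < 0 then 1 else 0) + 1 := by
  classical
  obtain ⟨ha02, ha12, ha20, ha21, has⟩ := ha
  obtain ⟨hk02, hk12, hk20, hk21, hks⟩ := hk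
  set P : ℝ[X] := (∑ l, (X : ℝ[X]) ^ d l • (S l).map C).det with hPdef
  have hP0 : P ≠ 0 := fun h0 => by
    rw [h0, Polynomial.roots_zero, Multiset.toFinset_zero, Finset.filter_empty, Finset.card_empty] at h19; omega
  set T : Finset ℕ := (Finset.univ : Finset (Fin 4 × Fin 4 × Fin 4)).image (fun p => d p.1 + d p.2.1 + d p.2.2) with hTdef
  have hT20 : T.card ≤ 20 := card_tripleSums_le_of_collapse d id (fun _ => rfl) (by decide)
  have hsum3 : (Finset.univ : Finset (Fin 3 → Fin 4)).image (fun g => ∑ t, d (g t)) = T := sumset_three_eq_tripleSums d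
  have hZ : ((Finset.univ : Finset (Fin 3 → Fin 4)).image (fun g => ∑ t, d (g t))).card
      ≤ (P.roots.toFinset.filter (fun t => 0 < t)).card + 1 := by rw [hsum3]; omega
  have hsupp : P.support = T := by rw [← hsum3]; exact support_det_pencil_eq_sumset_of_sharp d S hP0 hZ
  have hZ' : P.support.card ≤ (P.roots.toFinset.filter (fun t => 0 < t)).card + 1 := by rw [hsupp]; omega
  have memT : ∀ x y z : Fin 4, d x + d y + d z ∈ P.support := fun x y z => by
    rw [hsupp, hTdef]; exact Finset.mem_image.mpr ⟨(x, y, z), Finset.mem_univ _, rfl⟩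
  have hrank : ∀ e, (P.support.filter (· < e)).card = ρ e := fun e => by rw [hρ, hsupp]
  have hdetA := det_letter_ne_zero_of_nineteen d S h19 a; have hdetK := det_letter_ne_zero_of_nineteen d S h19 k
  rw [det_blockLetter _ ha02 ha12 ha20 ha21, has] at hdetA; rw [det_blockLetter _ hk02 hk12 hk20 hk21, hks] at hdetK
  have hla : S a 2 2 ≠ 0 := (mul_ne_zero_iff.mp hdetA).1
  have hlk : S k 2 2 ≠ 0 := (mul_ne_zero_iff.mp hdetK).1
  have hc0 : P.coeff (3 * d a) = S a 2 2 * (S a 0 0 * S a 1 1 - S a 0 1 ^ 2) := by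
    rw [hPdef, coeff_det_pencil_three_mul d S a (cube_unique_of_nineteen d S h19 a), det_blockLetter _ ha02 ha12 ha20 ha21, has]; ring
  have hc3 : P.coeff (3 * d k) = S k 2 2 * (S k 0 0 * S k 1 1 - S k 0 1 ^ 2) := by
    rw [hPdef, coeff_det_pencil_three_mul d S k (cube_unique_of_nineteen d S h19 k), det_blockLetter _ hk02 hk12 hk20 hk21, hks]; ring
  have hc1 : P.coeff (2 * d a + d k) = S k 2 2 * (S a 0 0 * S a 1 1 - S a 0 1 ^ 2)
      + S a 2 2 * (S a 0 0 * S k 1 1 - 2 * S a 0 1 * S k 0 1 + S a 1 1 * S k 0 0) := by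
    rw [hPdef, coeff_det_pencil_three_square d S hak (square_unique_of_nineteen d S h19 hak),
      trace_adjugate_blockLetters _ _ ha02 ha12 ha20 ha21 hk02 hk12 hk20 hk21, has, hks]; ring
  have hc2 : P.coeff (2 * d k + d a) = S k 2 2 * (S a 0 0 * S k 1 1 - 2 * S a 0 1 * S k 0 1 + S a 1 1 * S k 0 0)
      + S a 2 2 * (S k 0 0 * S k 1 1 - S k 0 1 ^ 2) := by
    rw [hPdef, coeff_det_pencil_three_square d S hak.symm (square_unique_of_nineteen d S h19 hak.symm),
      trace_adjugate_blockLetters _ _ hk02 hk12 hk20 hk21 ha02 ha12 ha20 ha21, has, hks]; ring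
  have m0 : 3 * d a ∈ P.support := by rw [show 3 * d a = d a + d a + d a by ring]; exact memT a a a
  have m3 : 3 * d k ∈ P.support := by rw [show 3 * d k = d k + d k + d k by ring]; exact memT k k k
  have m1 : 2 * d a + d k ∈ P.support := by rw [show 2 * d a + d k = d a + d a + d k by ring]; exact memT a a k
  have m2 : 2 * d k + d a ∈ P.support := by rw [show 2 * d k + d a = d k + d k + d a by ring]; exact memT k k a
  have r1 := pow_rank_mul_coeff_mul_coeff_pos_of_sharp P hZ' m0 m1; have r2 := pow_rank_mul_coeff_mul_coeff_pos_of_sharp P hZ' m1 m2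
  have r3 := pow_rank_mul_coeff_mul_coeff_pos_of_sharp P hZ' m2 m3
  rw [hrank, hrank] at r1 r2 r3
  exact mixedLin_sign_of_parities (la := S a 2 2) (lk := S k 2 2) hda hdk hla hlk hc0 hc1 hc2 hc3 r1 r2 r3

/-! ## 3. The law -/

/-- **COMMON-EIGENVECTOR LAW, MIXED CASE (all supports).**  Three letters `S_i, S_j, S_k` (indices `≠ m`) symmetric of block form with a common
eigenvector `e₂`; blocks of `S_i, S_j` definite, block of `S_k` INDEFINITE (`det < 0`); `S_m` arbitrary.  With `V_ak` the number of odd adjacent rank-sums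
on the edge `{a,k}` (a function of `d`): if `V_ik ∉ {1,2}` or `V_jk ∉ {1,2}`, the determinant has at most `18` distinct positive roots. [folklore] -/
theorem card_posRoots_commonEigMixed_le_18 (d : Fin 4 → ℕ) (S : Fin 4 → Matrix (Fin 3) (Fin 3) ℝ) (m i j k : Fin 4)
    (him : i ≠ m) (hjm : j ≠ m) (hkm : k ≠ m) (hik : i ≠ k) (hjk : j ≠ k)
    (hblock : ∀ l, l ≠ m → S l 0 2 = 0 ∧ S l 1 2 = 0 ∧ S l 2 0 = 0 ∧ S l 2 1 = 0 ∧ S l 1 0 = S l 0 1)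
    (hdi : 0 < S i 0 0 * S i 1 1 - S i 0 1 ^ 2) (hdj : 0 < S j 0 0 * S j 1 1 - S j 0 1 ^ 2) (hdk : S k 0 0 * S k 1 1 - S k 0 1 ^ 2 < 0)
    (ρ : ℕ → ℕ) (hρ : ∀ e, ρ e = (((Finset.univ : Finset (Fin 4 × Fin 4 × Fin 4)).image
      (fun p => d p.1 + d p.2.1 + d p.2.2)).filter (· < e)).card)
    (htest :
      let Vik := (ρ (3 * d i) + ρ (2 * d i + d k)) % 2 + (ρ (2 * d i + d k) + ρ (2 * d k + d i)) % 2
        + (ρ (2 * d k + d i) + ρ (3 * d k)) % 2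
      let Vjk := (ρ (3 * d j) + ρ (2 * d j + d k)) % 2 + (ρ (2 * d j + d k) + ρ (2 * d k + d j)) % 2
        + (ρ (2 * d k + d j) + ρ (3 * d k)) % 2
      Vik = 0 ∨ Vik = 3 ∨ Vjk = 0 ∨ Vjk = 3) :
    ((Matrix.det (∑ l, ((X : ℝ[X]) ^ d l) • (S l).map C)).roots.toFinset.filter (fun t => 0 < t)).card ≤ 18 := by
  by_contra hlt; push Not at hlt
  have h19 : 19 ≤ ((Matrix.det (∑ l, ((X : ℝ[X]) ^ d l) • (S l).map C)).roots.toFinset.filter (fun t => 0 < t)).card := by omega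
  have eik := mixed_edge_count d S hik (hblock i him) (hblock k hkm) hdi hdk h19 ρ hρ
  have ejk := mixed_edge_count d S hjk (hblock j hjm) (hblock k hkm) hdj hdk h19 ρ hρ
  dsimp only at htest
  rw [eik, ejk] at htest
  have bi : (if S i 2 2 * S k 2 2 < 0 then 1 else 0) ≤ 1 := by split_ifs <;> norm_num
  have bj : (if S j 2 2 * S k 2 2 < 0 then 1 else 0) ≤ 1 := by split_ifs <;> norm_num
  clear eik ejk hρ hlt h19
  set x : ℕ := (if S i 2 2 * S k 2 2 < 0 then 1 else 0) with hx
  set y : ℕ := (if S j 2 2 * S k 2 2 < 0 then 1 else 0) with hy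
  clear_value x y; omega

/-- **Congruence form** (three letters `Pᵀ D_l P` with a common eigenvector `P⁻¹e₂`, two definite blocks and one indefinite block). [folklore] -/
theorem card_posRoots_commonEigMixed_congr_le_18 (d : Fin 4 → ℕ) (D : Fin 4 → Matrix (Fin 3) (Fin 3) ℝ) (P : Matrix (Fin 3) (Fin 3) ℝ)
    (hP : P.det ≠ 0) (m i j k : Fin 4) (him : i ≠ m) (hjm : j ≠ m) (hkm : k ≠ m) (hik : i ≠ k) (hjk : j ≠ k)
    (hblock : ∀ l, l ≠ m → D l 0 2 = 0 ∧ D l 1 2 = 0 ∧ D l 2 0 = 0 ∧ D l 2 1 = 0 ∧ D l 1 0 = D l 0 1)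
    (hdi : 0 < D i 0 0 * D i 1 1 - D i 0 1 ^ 2) (hdj : 0 < D j 0 0 * D j 1 1 - D j 0 1 ^ 2) (hdk : D k 0 0 * D k 1 1 - D k 0 1 ^ 2 < 0)
    (ρ : ℕ → ℕ) (hρ : ∀ e, ρ e = (((Finset.univ : Finset (Fin 4 × Fin 4 × Fin 4)).image
      (fun p => d p.1 + d p.2.1 + d p.2.2)).filter (· < e)).card)
    (htest :
      let Vik := (ρ (3 * d i) + ρ (2 * d i + d k)) % 2 + (ρ (2 * d i + d k) + ρ (2 * d k + d i)) % 2
        + (ρ (2 * d k + d i) + ρ (3 * d k)) % 2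
      let Vjk := (ρ (3 * d j) + ρ (2 * d j + d k)) % 2 + (ρ (2 * d j + d k) + ρ (2 * d k + d j)) % 2
        + (ρ (2 * d k + d j) + ρ (3 * d k)) % 2
      Vik = 0 ∨ Vik = 3 ∨ Vjk = 0 ∨ Vjk = 3) :
    ((Matrix.det (∑ l, ((X : ℝ[X]) ^ d l) • (Pᵀ * D l * P).map C)).roots.toFinset.filter (fun t => 0 < t)).card ≤ 18 := by
  have hcongr := SpanRank.posRootCount_congr d D Pᵀ (by rwa [Matrix.det_transpose])
  simp only [Matrix.transpose_transpose] at hcongr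
  change posRootCount d (fun l => Pᵀ * D l * P) ≤ 18; rw [show posRootCount d (fun l => Pᵀ * D l * P) = posRootCount d D from hcongr]
  exact card_posRoots_commonEigMixed_le_18 d D m i j k him hjm hkm hik hjk hblock hdi hdj hdk ρ hρ htest

/-! ## 4. Instance -/

/-- **`(0,1,7,11)`, free letter at `X^0`, indefinite block at `X^1`** (`m = 0`, `k = 1`, definite blocks at `X^7, X^11`): the edge `{X^1, X^7}`
alternates `3` times, so at most `18` distinct positive roots. [folklore] -/
theorem card_posRoots_commonEigMixed_le_18_on_0_1_7_11 (S : Fin 4 → Matrix (Fin 3) (Fin 3) ℝ)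
    (hblock : ∀ l, l ≠ 0 → S l 0 2 = 0 ∧ S l 1 2 = 0 ∧ S l 2 0 = 0 ∧ S l 2 1 = 0 ∧ S l 1 0 = S l 0 1)
    (hd2 : 0 < S 2 0 0 * S 2 1 1 - S 2 0 1 ^ 2) (hd3 : 0 < S 3 0 0 * S 3 1 1 - S 3 0 1 ^ 2) (hd1 : S 1 0 0 * S 1 1 1 - S 1 0 1 ^ 2 < 0) :
    ((Matrix.det (∑ l, ((X : ℝ[X]) ^ ((![0, 1, 7, 11] : Fin 4 → ℕ) l)) • (S l).map C)).roots.toFinset.filter (fun t => 0 < t)).card ≤ 18 := by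
  have hT : ((Finset.univ : Finset (Fin 4 × Fin 4 × Fin 4)).image
      (fun p => (![0, 1, 7, 11] : Fin 4 → ℕ) p.1 + (![0, 1, 7, 11] : Fin 4 → ℕ) p.2.1 + (![0, 1, 7, 11] : Fin 4 → ℕ) p.2.2))
        = ({0, 1, 2, 3, 7, 8, 9, 11, 12, 13, 14, 15, 18, 19, 21, 22, 23, 25, 29, 33} : Finset ℕ) := by decide
  refine card_posRoots_commonEigMixed_le_18 _ S 0 2 3 1 (by decide) (by decide) (by decide) (by decide) (by decide) hblock hd2 hd3 hd1
    (fun e => ((({0, 1, 2, 3, 7, 8, 9, 11, 12, 13, 14, 15, 18, 19, 21, 22, 23, 25, 29, 33} : Finset ℕ)).filter (· < e)).card)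
    (fun e => by rw [hT]) ?_
  decide

/-! ## 5. One definite block and two indefinite blocks (appended) -/

/-- **COMMON-EIGENVECTOR LAW, ONE DEFINITE BLOCK.**  Letters `S_i, S_k, S_k'` (indices `≠ m`) symmetric block letters with a common eigenvector `e₂`;
block of `S_i` DEFINITE, blocks of `S_k, S_k'` INDEFINITE; `S_m` arbitrary.  The two edges `{i,k}`, `{i,k'}` are exact (`mixed_edge_count`), so if `d`
makes one of them alternate `0` or `3` times the determinant has at most `18` distinct positive roots.  (With `…CommonEigenvector` and §3 this covers
every common-eigenvector triple with nondegenerate blocks at least one of which is definite.) [folklore] -/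
theorem card_posRoots_commonEigOneDef_le_18 (d : Fin 4 → ℕ) (S : Fin 4 → Matrix (Fin 3) (Fin 3) ℝ) (m i k k' : Fin 4)
    (him : i ≠ m) (hkm : k ≠ m) (hk'm : k' ≠ m) (hik : i ≠ k) (hik' : i ≠ k')
    (hblock : ∀ l, l ≠ m → S l 0 2 = 0 ∧ S l 1 2 = 0 ∧ S l 2 0 = 0 ∧ S l 2 1 = 0 ∧ S l 1 0 = S l 0 1)
    (hdi : 0 < S i 0 0 * S i 1 1 - S i 0 1 ^ 2) (hdk : S k 0 0 * S k 1 1 - S k 0 1 ^ 2 < 0) (hdk' : S k' 0 0 * S k' 1 1 - S k' 0 1 ^ 2 < 0)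
    (ρ : ℕ → ℕ) (hρ : ∀ e, ρ e = (((Finset.univ : Finset (Fin 4 × Fin 4 × Fin 4)).image
      (fun p => d p.1 + d p.2.1 + d p.2.2)).filter (· < e)).card)
    (htest :
      let Vik := (ρ (3 * d i) + ρ (2 * d i + d k)) % 2 + (ρ (2 * d i + d k) + ρ (2 * d k + d i)) % 2
        + (ρ (2 * d k + d i) + ρ (3 * d k)) % 2
      let Vik' := (ρ (3 * d i) + ρ (2 * d i + d k')) % 2 + (ρ (2 * d i + d k') + ρ (2 * d k' + d i)) % 2
        + (ρ (2 * d k' + d i) + ρ (3 * d k')) % 2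
      Vik = 0 ∨ Vik = 3 ∨ Vik' = 0 ∨ Vik' = 3) :
    ((Matrix.det (∑ l, ((X : ℝ[X]) ^ d l) • (S l).map C)).roots.toFinset.filter (fun t => 0 < t)).card ≤ 18 := by
  by_contra hlt; push Not at hlt
  have h19 : 19 ≤ ((Matrix.det (∑ l, ((X : ℝ[X]) ^ d l) • (S l).map C)).roots.toFinset.filter (fun t => 0 < t)).card := by omega
  have eik := mixed_edge_count d S hik (hblock i him) (hblock k hkm) hdi hdk h19 ρ hρ
  have eik' := mixed_edge_count d S hik' (hblock i him) (hblock k' hk'm) hdi hdk' h19 ρ hρ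
  dsimp only at htest
  rw [eik, eik'] at htest
  have bi : (if S i 2 2 * S k 2 2 < 0 then 1 else 0) ≤ 1 := by split_ifs <;> norm_num
  have bj : (if S i 2 2 * S k' 2 2 < 0 then 1 else 0) ≤ 1 := by split_ifs <;> norm_num
  clear eik eik' hρ hlt h19
  set x : ℕ := (if S i 2 2 * S k 2 2 < 0 then 1 else 0) with hx
  set y : ℕ := (if S i 2 2 * S k' 2 2 < 0 then 1 else 0) with hy
  clear_value x y; omega

/-- **`(0,1,7,11)`, free letter at `X^0`: EVERY common-eigenvector triple with nondegenerate `2 × 2` blocks, at least one of them definite, gives at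
most `18` distinct positive roots** (the seven sign cases of the three block determinants, each closed by `…CommonEigenvector` / §3 / §5 with the
test decided on this support: `V₁₂ = 3`, `V₁₃ = 2`, `V₂₃ = 3`). [folklore] -/
theorem card_posRoots_commonEig_oneDefinite_le_18_on_0_1_7_11 (S : Fin 4 → Matrix (Fin 3) (Fin 3) ℝ)
    (hblock : ∀ l, l ≠ 0 → S l 0 2 = 0 ∧ S l 1 2 = 0 ∧ S l 2 0 = 0 ∧ S l 2 1 = 0 ∧ S l 1 0 = S l 0 1)
    (hnd : ∀ l, l ≠ 0 → S l 0 0 * S l 1 1 - S l 0 1 ^ 2 ≠ 0) (hex : ∃ l, l ≠ 0 ∧ 0 < S l 0 0 * S l 1 1 - S l 0 1 ^ 2) :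
    ((Matrix.det (∑ l, ((X : ℝ[X]) ^ ((![0, 1, 7, 11] : Fin 4 → ℕ) l)) • (S l).map C)).roots.toFinset.filter (fun t => 0 < t)).card ≤ 18 := by
  have hT : ((Finset.univ : Finset (Fin 4 × Fin 4 × Fin 4)).image
      (fun p => (![0, 1, 7, 11] : Fin 4 → ℕ) p.1 + (![0, 1, 7, 11] : Fin 4 → ℕ) p.2.1 + (![0, 1, 7, 11] : Fin 4 → ℕ) p.2.2)) = ({0, 1, 2, 3, 7, 8, 9, 11, 12, 13, 14, 15, 18, 19, 21, 22, 23, 25, 29, 33} : Finset ℕ) := by decide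
  have hρ : ∀ e, (fun e => ((({0, 1, 2, 3, 7, 8, 9, 11, 12, 13, 14, 15, 18, 19, 21, 22, 23, 25, 29, 33} : Finset ℕ)).filter (· < e)).card) e = (((Finset.univ : Finset (Fin 4 × Fin 4 × Fin 4)).image
      (fun p => (![0, 1, 7, 11] : Fin 4 → ℕ) p.1 + (![0, 1, 7, 11] : Fin 4 → ℕ) p.2.1 + (![0, 1, 7, 11] : Fin 4 → ℕ) p.2.2)).filter (· < e)).card := fun e => by rw [hT]
  rcases lt_or_gt_of_ne (hnd 1 (by decide)) with n1 | p1 <;> rcases lt_or_gt_of_ne (hnd 2 (by decide)) with n2 | p2 <;>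
    rcases lt_or_gt_of_ne (hnd 3 (by decide)) with n3 | p3
  · exfalso; obtain ⟨l, hl, hpos⟩ := hex
    fin_cases l
    · exact absurd rfl hl
    · exact absurd hpos (not_lt.mpr n1.le)
    · exact absurd hpos (not_lt.mpr n2.le)
    · exact absurd hpos (not_lt.mpr n3.le)
  · exact card_posRoots_commonEigOneDef_le_18 _ S 0 3 1 2 (by decide) (by decide) (by decide) (by decide) (by decide) hblock p3 n1 n2
      (fun e => ((({0, 1, 2, 3, 7, 8, 9, 11, 12, 13, 14, 15, 18, 19, 21, 22, 23, 25, 29, 33} : Finset ℕ)).filter (· < e)).card) hρ (by decide)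
  · exact card_posRoots_commonEigOneDef_le_18 _ S 0 2 1 3 (by decide) (by decide) (by decide) (by decide) (by decide) hblock p2 n1 n3
      (fun e => ((({0, 1, 2, 3, 7, 8, 9, 11, 12, 13, 14, 15, 18, 19, 21, 22, 23, 25, 29, 33} : Finset ℕ)).filter (· < e)).card) hρ (by decide)
  · exact card_posRoots_commonEigMixed_le_18 _ S 0 2 3 1 (by decide) (by decide) (by decide) (by decide) (by decide) hblock p2 p3 n1
      (fun e => ((({0, 1, 2, 3, 7, 8, 9, 11, 12, 13, 14, 15, 18, 19, 21, 22, 23, 25, 29, 33} : Finset ℕ)).filter (· < e)).card) hρ (by decide)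
  · exact card_posRoots_commonEigOneDef_le_18 _ S 0 1 2 3 (by decide) (by decide) (by decide) (by decide) (by decide) hblock p1 n2 n3
      (fun e => ((({0, 1, 2, 3, 7, 8, 9, 11, 12, 13, 14, 15, 18, 19, 21, 22, 23, 25, 29, 33} : Finset ℕ)).filter (· < e)).card) hρ (by decide)
  · exact card_posRoots_commonEigMixed_le_18 _ S 0 1 3 2 (by decide) (by decide) (by decide) (by decide) (by decide) hblock p1 p3 n2
      (fun e => ((({0, 1, 2, 3, 7, 8, 9, 11, 12, 13, 14, 15, 18, 19, 21, 22, 23, 25, 29, 33} : Finset ℕ)).filter (· < e)).card) hρ (by decide)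
  · exact card_posRoots_commonEigMixed_le_18 _ S 0 1 2 3 (by decide) (by decide) (by decide) (by decide) (by decide) hblock p1 p2 n3
      (fun e => ((({0, 1, 2, 3, 7, 8, 9, 11, 12, 13, 14, 15, 18, 19, 21, 22, 23, 25, 29, 33} : Finset ℕ)).filter (· < e)).card) hρ (by decide)
  · exact card_posRoots_commonEig_le_18 _ S 0 1 2 3 (by decide) (by decide) (by decide) (by decide) (by decide) (by decide) hblock
      (fun l hl => by fin_cases l <;> first | exact absurd rfl hl | exact p1 | exact p2 | exact p3) (fun e => ((({0, 1, 2, 3, 7, 8, 9, 11, 12, 13, 14, 15, 18, 19, 21, 22, 23, 25, 29, 33} : Finset ℕ)).filter (· < e)).card) hρ (by decide)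

end Summit.ValiantsHypothesis.ValiantsHypothesis.Theorems.LacunarySymmetroidMatrixDescartes.Census
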